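import Summits.MatrixMultiplication.MatrixMultiplication.Theorems.SoloBlindTopLayerCongruence
import Summits.MatrixMultiplication.MatrixMultiplication.Theorems.SoloBlindMassCalculus
import Summits.MatrixMultiplication.MatrixMultiplication.Theorems.SoloBlindTopLayerOlson

/-!
# Conjecture C (the complement law) and what it does on the top layer

For a zero-sum-free `S`, an H-good target `σ` and a representation `T` of `σ` (`∑_{i ∈ T} h i = σ`),
CONJECTURE C (KraftK3 K3.28 (v)) asserts

  `E(σ; S) ≤ B(|T|, |S|) = 1/2 + 2^{-|T|} - 2^{-(|S| + 1 - |T|)}`,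

the layer-defect bound of Conjecture E♭ (`soloBlindEFlatBound`) with the rank replaced by the size of ANY
representation.  This file records, sorry-free:

* `soloBlind_mass_expand` — the EXPANSION IDENTITY behind the 'clean-target' form of C: for `U ⊆ S`,
  `E(τ; S) = ∑_{B ⊆ U} 2^{-|B|} · E(τ - ∑_{i ∈ B} h i; S \ U)` (iterated deletion identity); with `U = S \ T`
  for a representation `T` this writes `E(σ; S) - 2^{-|T|}` as a weighted sum of masses of the `2^{|U|} - 1`
  shifted targets of the zero-sum-free set `T`;
* `soloBlindComplementLaw` — Conjecture C for one pair, as a `Prop`;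
* `soloBlindCL_two_mul_card_le` — C forces `2 |T| ≤ |S| + 1` for every representation of an E-tight target (DEG);
* `soloBlindCL_conjE_top`, `soloBlindCL_second_value_top` — ON THE TOP LAYER `|S| + 1 = 2 r` the complement law
  implies CONJECTURE E (`E(σ; S) ≤ 1/2`) and the second-value law (`E ≠ 1/2 → E ≤ 1/2 - 3 · 2^{-(r+1)}`), via the
  top-layer Kraft congruence `soloBlindTLC_gap`; in fact any bound `E < 1/2 + 3 · 2^{-M}` at a largest
  representation suffices for E there (`soloBlind_conjE_top_of_lt`).

No conjecture is assumed as an axiom: C enters only as an explicit hypothesis.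
-/

namespace Summit.MatrixMultiplication.MatrixMultiplication.Theorems

open Finset

universe u

variable {ι : Type*} [DecidableEq ι]
variable {G : Type u} [AddCommGroup G] [DecidableEq G]

/-- EXPANSION IDENTITY: for `U ⊆ S`, `E(τ; S) = ∑_{B ⊆ U} 2^{-|B|} E(τ - ∑_{i∈B} h i; S \ U)`. -/
theorem soloBlind_mass_expand (h : ι → G) (S U : Finset ι) (hU : U ⊆ S) (τ : G) :
    soloBlindMass h S τ =
      ∑ B ∈ U.powerset, (1 / 2 : ℚ) ^ B.card * soloBlindMass h (S \ U) (τ - ∑ i ∈ B, h i) := by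
  induction U using Finset.induction_on generalizing τ with
  | empty => simp
  | insert x U hx ih =>
    have hxS : x ∈ S := hU (mem_insert_self x U)
    have hUS : U ⊆ S := fun i hi => hU (mem_insert_of_mem hi)
    have hxSU : x ∈ S \ U := mem_sdiff.2 ⟨hxS, hx⟩
    have hsd : S \ insert x U = (S \ U).erase x := by
      ext i
      simp only [mem_sdiff, mem_insert, mem_erase, not_or]
      tauto
    rw [ih hUS, sum_powerset_insert hx]
    have step : ∀ B ∈ U.powerset,
        (1 / 2 : ℚ) ^ B.card * soloBlindMass h (S \ U) (τ - ∑ i ∈ B, h i) =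
          (1 / 2 : ℚ) ^ B.card * soloBlindMass h (S \ insert x U) (τ - ∑ i ∈ B, h i) +
            (1 / 2 : ℚ) ^ (insert x B).card *
              soloBlindMass h (S \ insert x U) (τ - ∑ i ∈ insert x B, h i) := by
      intro B hB
      have hxB : x ∉ B := fun hxB => hx (mem_powerset.1 hB hxB)
      rw [soloBlind_mass_erase h hxSU, hsd, card_insert_of_notMem hxB, sum_insert hxB, pow_succ]
      have : τ - (h x + ∑ i ∈ B, h i) = τ - ∑ i ∈ B, h i - h x := by abel
      rw [this]
      ring
    rw [sum_congr rfl step, sum_add_distrib]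

/-- For a zero-sum-free `T` representing `σ`, the only representation of `σ` inside `T` is `T` itself, so
`E(σ; T) = 2^{-|T|}`. -/
theorem soloBlind_mass_self_of_zsf (h : ι → G) (T : Finset ι) (σ : G)
    (zsf : ∀ A ⊆ T, A.Nonempty → ∑ i ∈ A, h i ≠ 0) (hT : ∑ i ∈ T, h i = σ) :
    soloBlindMass h T σ = (1 / 2 : ℚ) ^ T.card := by
  have hrep : soloBlindSeqRepAll h T σ = {T} := by
    ext A
    rw [soloBlind_mem_seqRepAll, mem_singleton]
    constructor
    · rintro ⟨hAT, hA⟩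
      by_contra hne
      have hne' : (T \ A).Nonempty := by
        rw [sdiff_nonempty]
        exact fun hTA => hne (Subset.antisymm hAT hTA)
      apply zsf (T \ A) sdiff_subset hne'
      have := sum_sdiff hAT (f := h)
      rw [hA, hT] at this
      simpa using this
    · rintro rfl
      exact ⟨Subset.rfl, hT⟩
  rw [soloBlindMass, hrep, sum_singleton]

/-- CLEAN-TARGET FORM of the left side of C: for a representation `T ⊆ S` of `σ` with `T` zero-sum free,
`E(σ; S) = 2^{-|T|} + ∑_{∅ ≠ B ⊆ S \ T} 2^{-|B|} E(σ - ∑_{i∈B} h i; T)`. -/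
theorem soloBlind_mass_expand_rep (h : ι → G) (S T : Finset ι) (hTS : T ⊆ S) (σ : G)
    (zsf : ∀ A ⊆ T, A.Nonempty → ∑ i ∈ A, h i ≠ 0) (hT : ∑ i ∈ T, h i = σ) :
    soloBlindMass h S σ = (1 / 2 : ℚ) ^ T.card +
      ∑ B ∈ (S \ T).powerset.erase ∅, (1 / 2 : ℚ) ^ B.card * soloBlindMass h T (σ - ∑ i ∈ B, h i) := by
  have hST : S \ (S \ T) = T := by
    rw [sdiff_sdiff_right_self, inf_eq_inter, inter_eq_right.2 hTS]
  rw [soloBlind_mass_expand h S (S \ T) sdiff_subset σ, hST, ← add_sum_erase _ _ (empty_mem_powerset _)]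
  simp [soloBlind_mass_self_of_zsf h T σ zsf hT]

/-- CONJECTURE C (the complement law) for the pair `(S, σ)`: every representation `T` of `σ` gives
`E(σ; S) ≤ B(|T|, |S|) = 1/2 + 2^{-|T|} - 2^{-(|S|+1-|T|)}`. -/
def soloBlindComplementLaw (h : ι → G) (S : Finset ι) (σ : G) : Prop :=
  ∀ T ⊆ S, ∑ i ∈ T, h i = σ → soloBlindMass h S σ ≤ soloBlindEFlatBound T.card S.card

omit [DecidableEq ι] in
/-- C ⟹ DEG: under the complement law an E-tight target (`E = 1/2`) has only representations `T` with
`2 |T| ≤ |S| + 1`. -/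
theorem soloBlindCL_two_mul_card_le (h : ι → G) (S : Finset ι) (σ : G)
    (hC : soloBlindComplementLaw h S σ) (htight : soloBlindMass h S σ = 1 / 2)
    (T : Finset ι) (hTS : T ⊆ S) (hT : ∑ i ∈ T, h i = σ) : 2 * T.card ≤ S.card + 1 := by
  have hle := hC T hTS hT
  rw [htight, soloBlindEFlatBound] at hle
  have hpow : (1 / 2 : ℚ) ^ (S.card + 1 - T.card) ≤ (1 / 2 : ℚ) ^ T.card := by linarith
  rw [pow_le_pow_iff_right_of_lt_one₀ (by norm_num) (by norm_num)] at hpow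
  omega

/-- The bound of C lies strictly below `1/2 + 3 · 2^{-|T|}`. -/
theorem soloBlindEFlatBound_lt (m c : ℕ) : soloBlindEFlatBound m c < 1 / 2 + 3 / 2 ^ m := by
  unfold soloBlindEFlatBound
  have h1 : (0 : ℚ) < (1 / 2 : ℚ) ^ (c + 1 - m) := by positivity
  have h2 : (3 : ℚ) / 2 ^ m = 3 * (1 / 2 : ℚ) ^ m := by rw [one_div_pow, mul_one_div]
  have h3 : (0 : ℚ) < (1 / 2 : ℚ) ^ m := by positivity
  rw [h2]
  linarith

variable {r : ℕ}

/-- ON THE TOP LAYER a weak upper bound suffices for Conjecture E: if `|S| + 1 = 2 r`, `S` is zero-sum free,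
`σ` is H-good and `E(σ; S) < 1/2 + 3 · 2^{-M}` where `M` bounds the sizes of the representations, then
`E(σ; S) ≤ 1/2` (by the top-layer Kraft congruence). -/
theorem soloBlind_conjE_top_of_lt (h : ι → (Fin r → ZMod 3)) (S : Finset ι) (σ : Fin r → ZMod 3)
    (zsf : ∀ T ⊆ S, T.Nonempty → ∑ i ∈ T, h i ≠ 0) (hσ : ∀ T ⊆ S, σ + ∑ i ∈ T, h i ≠ 0)
    (hcard : S.card + 1 = 2 * r) (M : ℕ) (hM1 : 1 ≤ M) (hMc : M ≤ S.card)
    (hM : ∀ T ⊆ S, ∑ i ∈ T, h i = σ → T.card ≤ M)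
    (hlt : soloBlindMass h S σ < 1 / 2 + 3 / 2 ^ M) : soloBlindMass h S σ ≤ 1 / 2 := by
  rcases soloBlindTLC_gap h S σ zsf hσ hcard M hM1 hMc hM with h1 | h2 | h3
  · rw [h1]
  · have : (0 : ℚ) ≤ 3 / 2 ^ M := by positivity
    linarith
  · linarith

omit [DecidableEq ι] in
/-- On the top layer an H-good target HAS a representation (`soloBlindTLO_target_mem_sums`), hence a largest
one `T`: nonempty, of size between `1` and `|S|`, bounding every representation. -/
theorem soloBlind_exists_max_rep_top (h : ι → (Fin r → ZMod 3)) (S : Finset ι) (σ : Fin r → ZMod 3)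
    (zsf : ∀ T ⊆ S, T.Nonempty → ∑ i ∈ T, h i ≠ 0) (hσ : ∀ T ⊆ S, σ + ∑ i ∈ T, h i ≠ 0)
    (hcard : S.card + 1 = 2 * r) :
    ∃ T ⊆ S, ∑ i ∈ T, h i = σ ∧ 1 ≤ T.card ∧ T.card ≤ S.card ∧
      ∀ T' ⊆ S, ∑ i ∈ T', h i = σ → T'.card ≤ T.card := by
  obtain ⟨V, hVS, hV⟩ := soloBlindTLO_target_mem_sums h S σ (by omega) zsf hσ
  have hne : (soloBlindSeqRepAll h S σ).Nonempty := ⟨V, soloBlind_mem_seqRepAll.2 ⟨hVS, hV⟩⟩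
  obtain ⟨T, hT, hmax⟩ := exists_max_image (soloBlindSeqRepAll h S σ) Finset.card hne
  obtain ⟨hTS, hTσ⟩ := soloBlind_mem_seqRepAll.1 hT
  have hTne : T.Nonempty := by
    rw [nonempty_iff_ne_empty]
    rintro rfl
    apply hσ ∅ (empty_subset _)
    rw [sum_empty] at hTσ
    rw [sum_empty, add_zero, ← hTσ]
  exact ⟨T, hTS, hTσ, card_pos.2 hTne, card_le_card hTS,
    fun T' hT'S hT' => hmax T' (soloBlind_mem_seqRepAll.2 ⟨hT'S, hT'⟩)⟩

/-- C ⟹ E ON THE TOP LAYER: for zero-sum-free `S ⊆ 𝔽₃^r` with `|S| + 1 = 2 r` and an H-good `σ`, the complement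
law gives `E(σ; S) ≤ 1/2`. -/
theorem soloBlindCL_conjE_top (h : ι → (Fin r → ZMod 3)) (S : Finset ι) (σ : Fin r → ZMod 3)
    (zsf : ∀ T ⊆ S, T.Nonempty → ∑ i ∈ T, h i ≠ 0) (hσ : ∀ T ⊆ S, σ + ∑ i ∈ T, h i ≠ 0)
    (hcard : S.card + 1 = 2 * r) (hC : soloBlindComplementLaw h S σ) :
    soloBlindMass h S σ ≤ 1 / 2 := by
  obtain ⟨T, hTS, hTσ, h1, hc, hmax⟩ := soloBlind_exists_max_rep_top h S σ zsf hσ hcard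
  exact soloBlind_conjE_top_of_lt h S σ zsf hσ hcard T.card h1 hc hmax
    (lt_of_le_of_lt (hC T hTS hTσ) (soloBlindEFlatBound_lt T.card S.card))

/-- C ⟹ THE SECOND-VALUE LAW ON THE TOP LAYER: with `|S| + 1 = 2 r`, if `E(σ; S) ≠ 1/2` then
`E(σ; S) ≤ 1/2 - 3 · 2^{-(r+1)}` (attained by the lift orbit of `5/16`, KraftK3 K3.27). -/
theorem soloBlindCL_second_value_top (h : ι → (Fin r → ZMod 3)) (S : Finset ι) (σ : Fin r → ZMod 3)
    (zsf : ∀ T ⊆ S, T.Nonempty → ∑ i ∈ T, h i ≠ 0) (hσ : ∀ T ⊆ S, σ + ∑ i ∈ T, h i ≠ 0)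
    (hcard : S.card + 1 = 2 * r) (hC : soloBlindComplementLaw h S σ)
    (hne : soloBlindMass h S σ ≠ 1 / 2) :
    soloBlindMass h S σ ≤ 1 / 2 - 3 / 2 ^ (r + 1) := by
  obtain ⟨T, hTS, hTσ, h1, hMc, hmax⟩ := soloBlind_exists_max_rep_top h S σ zsf hσ hcard
  have hCT := hC T hTS hTσ
  rcases soloBlindTLC_gap h S σ zsf hσ hcard T.card h1 hMc hmax with e1 | e2 | e3
  · exact absurd e1 hne
  · by_cases hsmall : T.card ≤ r + 1
    · -- representations of size ≤ r + 1: the congruence gap 3 · 2^{-|T|} is already ≥ 3 · 2^{-(r+1)}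
      have : (3 : ℚ) / 2 ^ (r + 1) ≤ 3 / 2 ^ T.card := by
        apply div_le_div_of_nonneg_left (by norm_num) (by positivity)
        exact pow_le_pow_right₀ (by norm_num) hsmall
      linarith
    · -- a representation of size ≥ r + 2 (so r ≥ 3): the complement-law bound itself is small enough
      push Not at hsmall
      unfold soloBlindEFlatBound at hCT
      have hr : 3 ≤ r := by omega
      have ha : (0 : ℚ) < (1 / 2 : ℚ) ^ (r + 2) := by positivity
      have f1 : (1 / 2 : ℚ) ^ T.card ≤ (1 / 2 : ℚ) ^ (r + 2) :=
        pow_le_pow_of_le_one (by norm_num) (by norm_num) hsmall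
      have f2 : (1 / 2 : ℚ) ^ (r - 2) ≤ (1 / 2 : ℚ) ^ (S.card + 1 - T.card) :=
        pow_le_pow_of_le_one (by norm_num) (by norm_num) (by omega)
      have f3 : (1 / 2 : ℚ) ^ (r + 2) = (1 / 2 : ℚ) ^ (r - 2) * (1 / 2 : ℚ) ^ 4 := by
        rw [← pow_add]; congr 1; omega
      have f4 : (3 : ℚ) / 2 ^ (r + 1) = 6 * (1 / 2 : ℚ) ^ (r + 2) := by
        rw [one_div_pow, pow_succ, pow_succ, mul_one_div]
        field_simp
        ring
      rw [f4]
      nlinarith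
  · exact absurd (lt_of_le_of_lt hCT (soloBlindEFlatBound_lt T.card S.card)) (not_lt.2 e3)

end Summit.MatrixMultiplication.MatrixMultiplication.Theorems
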